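import Summits.ResolutionOfSingularities.ResolutionOfSingularities.Theorems.FrobeniusClosingSteerNoSingularCarrier
import Summits.ResolutionOfSingularities.ResolutionOfSingularities.Theorems.FrobeniusClosingSteerCore4SteeredRegular
import Literature.AlgebraicGeometry.Resolution.BlowupChartClosureQuotient
import HarnessLib

/-!
# No singular carrier along a σ_top-steered run — part 2: ONE STEERED STEP
# ((N4) of res-L0-w41-plan-1 RULING 7 §σ2.20 «NORMALISED START», W4.1 crux `Steer`)

W4.1, crux `Steer` (stmt-ResolutionOfSingularities-16345), §σ2.20 (res-L0-w41-plan-1 RULING 7 2026-08-27T07:54:40Z):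
(N4) `noSingularCarrier_along_run`. Part 1 (`…NoSingularCarrier.lean`, p514035) proved the carrier dichotomy at one
stage: under `NoSingularCarrier` EITHER `NormalAt` holds OR the σ_top centre is a principal prime divisor `(π)`. This
part treats the two kinds of steered step `R ⊂ R'` (bodies of `IsLocalBlowupAlong` / `IsExcParamAlong` /
`IsStrictStepAlong` / `NoSingularCarrier` unfolded; Theses-free, def-free):

* `eq_of_isLocalBlowupAlong_span_singleton` — **a divisor step is trivial on the base**: the local blowing up of a
  local `R = R_{𝔪_O ∩ R}` along a PRINCIPAL ideal `(π)` with respect to `O` is `R` itself (the chart `R[(π)/x]` of a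
  generator `x = π a₀` of maximal value only adjoins `a/a₀` with `a₀` a unit at the centre);
* `noSingularCarrier_of_divisorStep` — **a divisor step creates no new carrier**: if `R' = R` and `s = x·s' + g`
  (`x, g ∈ R`), every carrier `(G, H, U)` of `s'` gives the carrier `(xG + g, xH, U)` of `s` (Frobenius), so
  `NoSingularCarrier` passes from `(R, s)` to `(R', s')`;
* `isRegularLocalRing_quotient_span_excParam` — **the exceptional prime of a step along a REGULAR centre is
  regular**: for `R` regular local dominated by `O`, `P ≤ 𝔪_R` with `R ⧸ P` regular, `R'` the local blowing up along
  `P` and `x ∈ P` an exceptional parameter (maximal value), `R' ⧸ (x)` is a regular local ring — `P` is generated by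
  part `c` of a regular system of parameters (quasi-regular), `R' = (R[P/c_i])_{centre}` for a `c_i` of maximal value
  (uniqueness of the local blowing up), `R[P/c_i]/(c_i) ≅ (R/P)[T_j]` is regular
  (`Literature…closure_chartQuotient`), quotient and localisation commute (res-D-pv-011's
  `isRegularLocalRing_locAtCentre_quotient`), and `x/c_i` is a unit of `R'`.

Part 3 (`…NoSingularCarrierRun.lean`): from a `NormalAt` stage no singular carrier survives ANY steered step (a
height-one prime of `R'` off the exceptional prime is birational to a height-one prime `(π)` of `R`, where the
local Frobenius congruence is global by (N5), contradicting `NormalAt`), and the induction. OURS (the W4.1 engine;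
res-L0-w41-plan-1 RULING 7; AI review weaker than expert review); nothing here is attributed to
[claim: Hironaka2017]. [cite: NovacoskiSpivakovsky2014, Def. 2.11] [cite: Matsumura1987, Thm. 14.2]
[cite: StacksProject, Tag 0BIQ]
-/

noncomputable section

-- `Summit.<S>.<S>.…` duplicates the summit name by design (single-problem summit).
set_option linter.dupNamespace false

open Polynomial IsLocalRing Literature.AlgebraicGeometry.Resolution

namespace Summit.ResolutionOfSingularities.ResolutionOfSingularities.Theorems.SwitchingDichotomy.NoSingularCarrier

variable {K : Type} [Field K]

/-! ## §1 A divisor step is trivial on the base -/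

/-- **The local blowing up along a principal ideal is trivial.** If `R ⊆ O` is its own local ring at the centre of
`O` (`R_{𝔪_O ∩ R} = R`, e.g. any member of a steered run) and `R'` is the local blowing up of `R` along the principal
ideal `(π)` with respect to `O`, then `R' = R`: writing the chart generator of maximal value as `x = π·a₀` and any
`y ∈ (π)` as `y = π·a`, maximality against `π` itself gives `v(a₀) = 1`, so `y/x = a/a₀ ∈ R_{centre} = R`.
OURS (W4.1 engine, RULING 7 (N4): «B1's divisor steps strip carriers» happen in a FIXED ring).
[cite: NovacoskiSpivakovsky2014, Def. 2.11] -/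
theorem eq_of_isLocalBlowupAlong_span_singleton {O : ValuationSubring K} {R R' : Subring K}
    (hloc : locAtCentre R O = R) (π : R) (hbl : IsLocalBlowupAlong O R (Ideal.span {π}) R') : R' = R := by
  have hRO : R ≤ O.toSubring := hbl.1
  obtain ⟨x, hxP, hx0, hmax, rfl⟩ := SteeredRun.exists_eq_locAtCentre_of_isLocalBlowupAlong hbl
  -- `x = π a₀` with `v(a₀) = 1`
  obtain ⟨a₀, ha₀⟩ := Ideal.mem_span_singleton'.mp hxP
  have hπ0 : (π : K) ≠ 0 := by
    intro h
    apply hx0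
    apply Subtype.ext
    change (x : K) = 0
    rw [← ha₀, Subring.coe_mul, h, mul_zero]
  have hva₀ : O.valuation (a₀ : K) = 1 := by
    have h1 := hmax π (Ideal.mem_span_singleton_self π)
    rw [← ha₀, Subring.coe_mul, map_mul] at h1
    have hvπ0 : O.valuation (π : K) ≠ 0 := (_root_.map_ne_zero _).mpr hπ0
    have hle1 : O.valuation (a₀ : K) ≤ 1 := (O.valuation_le_one_iff _).mpr (hRO a₀.2)
    refine le_antisymm hle1 ?_
    by_contra hlt
    push Not at hlt
    have : O.valuation (a₀ : K) * O.valuation (π : K) < 1 * O.valuation (π : K) :=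
      mul_lt_mul_of_pos_right hlt (zero_lt_iff.mpr hvπ0)
    rw [one_mul] at this
    exact not_le.mpr this h1
  -- the chart ring lies in `R_{centre} = R`
  have hC : Subring.closure ((R : Set K) ∪ (fun y : R => (y : K) / x) '' (Ideal.span {π} : Set R)) ≤ R := by
    refine Subring.closure_le.mpr ?_
    rintro z (hz | ⟨y, hy, rfl⟩)
    · exact hz
    · obtain ⟨a, ha⟩ := Ideal.mem_span_singleton'.mp (show (y : R) ∈ Ideal.span {π} from hy)
      have hmem : ((y : R) : K) / (x : K) ∈ locAtCentre R O := by
        rw [mem_locAtCentre_iff]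
        refine ⟨a, a.2, a₀, a₀.2, hva₀, ?_⟩
        have ha₀0 : (a₀ : K) ≠ 0 := ne_zero_of_valuation_eq_one hva₀
        rw [← ha, ← ha₀, Subring.coe_mul, Subring.coe_mul]
        field_simp
      rw [hloc] at hmem
      exact hmem
  have hRC : R ≤ Subring.closure ((R : Set K) ∪ (fun y : R => (y : K) / x) '' (Ideal.span {π} : Set R)) :=
    fun z hz => Subring.subset_closure (Or.inl hz)
  apply le_antisymm
  · calc locAtCentre _ O ≤ locAtCentre R O := locAtCentre_mono O hC
      _ = R := hloc
  · calc R = locAtCentre R O := hloc.symm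
      _ ≤ locAtCentre _ O := locAtCentre_mono O hRC

/-! ## §2 A divisor step creates no new carrier -/

/-- **`NoSingularCarrier` survives a divisor step.** In characteristic `p`, if `s = x·s' + g` with `x, g ∈ R`, every
carrier `(G, H, U)` of `s'` over `R` (`s' ^ p = G ^ p + H ^ p·U`) yields the carrier `(x G + g, x H, U)` of `s`
(`(a + b)^p = a^p + b^p`); a prime factor `q` of `H` divides `x H`, so the body of strat-2's `NoSingularCarrier O R p s`
gives that of `NoSingularCarrier O R p s'` — stated for a second copy `R'` of the base with `R' = R` (the trivial
divisor step of §1), as the run presents it. OURS (W4.1 engine, RULING 7 (N4)). [folklore] -/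
theorem noSingularCarrier_of_divisorStep (p : ℕ) [Fact p.Prime] [CharP K p]
    {R R' : Subring K} (hRR' : R' = R) {s s' x g : K} (hx : x ∈ R) (hg : g ∈ R) (hstep : s = x * s' + g)
    (hNSC : ∀ g h u : K, g ∈ R → ∀ hh : h ∈ R, u ∈ R → s ^ p = g ^ p + h ^ p * u →
      ∀ q : R, Prime q → q ∣ (⟨h, hh⟩ : R) → IsRegularLocalRing (R ⧸ Ideal.span {q})) :
    ∀ g h u : K, g ∈ R' → ∀ hh : h ∈ R', u ∈ R' → s' ^ p = g ^ p + h ^ p * u →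
      ∀ q : R', Prime q → q ∣ (⟨h, hh⟩ : R') → IsRegularLocalRing (R' ⧸ Ideal.span {q}) := by
  subst hRR'
  intro G H U hG hH hU heq q hq hqH
  have hp : p.Prime := Fact.out
  haveI : ExpChar K p := ExpChar.prime hp
  -- the carrier `(xG + g, xH, U)` of `s`
  have hcar : s ^ p = (x * G + g) ^ p + (x * H) ^ p * U := by
    rw [hstep, add_pow_expChar (x * s') g p, add_pow_expChar (x * G) g p, mul_pow, mul_pow, heq]
    ring
  have hqxH : q ∣ (⟨x * H, R'.mul_mem hx hH⟩ : R') := by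
    have : (⟨x * H, R'.mul_mem hx hH⟩ : R') = ⟨x, hx⟩ * ⟨H, hH⟩ := rfl
    rw [this]
    exact Dvd.dvd.mul_left hqH _
  exact hNSC (x * G + g) (x * H) U (R'.add_mem (R'.mul_mem hx hG) hg) (R'.mul_mem hx hH) hU hcar q hq hqxH

/-! ## §3 The exceptional prime of a step along a regular centre is regular -/

/-- Values on an ideal are bounded by the maximal value of a generating family (non-archimedean triangle
inequality). [folklore] -/
theorem valuation_le_of_mem_span_range {O : ValuationSubring K} {R : Subring K} (hRO : R ≤ O.toSubring)
    {r : ℕ} (c : Fin r → R) (i : Fin r) (hmax : ∀ j, O.valuation ((c j : R) : K) ≤ O.valuation ((c i : R) : K))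
    (y : R) (hy : y ∈ Ideal.span (Set.range c)) : O.valuation (y : K) ≤ O.valuation ((c i : R) : K) := by
  induction hy using Submodule.span_induction with
  | mem y hy =>
    obtain ⟨j, rfl⟩ := hy
    exact hmax j
  | zero => simp
  | add y z _ _ hy hz =>
    rw [Subring.coe_add]
    exact (Valuation.map_add _ _ _).trans (max_le hy hz)
  | smul a y _ hy =>
    rw [smul_eq_mul, Subring.coe_mul, map_mul]
    calc O.valuation (a : K) * O.valuation (y : K) ≤ 1 * O.valuation ((c i : R) : K) :=
          mul_le_mul' ((O.valuation_le_one_iff _).mpr (hRO a.2)) hy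
      _ = O.valuation ((c i : R) : K) := one_mul _

/-- **The exceptional prime of a local blowing up along a REGULAR centre is regular.** Let `R ⊆ K` be a regular
local subring dominated by the valuation ring `O` (`a ∈ 𝔪_R ↔ v(a) < 1`), `P ≤ 𝔪_R` an ideal with `R ⧸ P` a regular
local ring (a σ_top-permissible centre, or `P = 𝔪_R`), `R'` the local blowing up of `R` along `P` with respect to `O`,
and `x` an exceptional parameter along `P` (body of `IsExcParamAlong O R P x`: `x ∈ P`, `x ≠ 0`, of maximal value on
`P`). Then `x ∈ R'` and `R' ⧸ (x)` is a regular local ring (so `(x)` is the exceptional PRIME of `R'`). `P` is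
generated by part `c` of a regular system of parameters (quasi-regular); `R' = (R[P/c_i])_{centre}` for a `c_i` of
maximal value (uniqueness of the local blowing up); `R[P/c_i]/(c_i) ≅ (R/P)[T_j : j ≠ i]` is a regular ring
(`closure_chartQuotient`); quotient and localisation commute (`DivisorTrigger.isRegularLocalRing_locAtCentre_quotient`);
and `x/c_i` is a unit of `R'`, so `(x) = (c_i)`. OURS (W4.1 engine, RULING 7 (N4)).
[cite: NovacoskiSpivakovsky2014, Def. 2.11] [cite: StacksProject, Tag 0BIQ] -/
theorem isRegularLocalRing_quotient_span_excParam {O : ValuationSubring K} {R R' : Subring K}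
    [IsRegularLocalRing R] (hval : ∀ a : R, a ∈ maximalIdeal R ↔ O.valuation (a : K) < 1)
    {P : Ideal R} (hP : P ≤ maximalIdeal R) [IsRegularLocalRing (R ⧸ P)]
    (hbl : IsLocalBlowupAlong O R P R') {x : K}
    (hx : (∃ hxR : x ∈ R, (⟨x, hxR⟩ : R) ∈ P) ∧ x ≠ 0 ∧
      ∀ y : R, y ∈ P → O.valuation (y : K) ≤ O.valuation x) :
    ∃ hxR' : x ∈ R', IsRegularLocalRing (R' ⧸ Ideal.span {(⟨x, hxR'⟩ : R')}) := by
  classical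
  obtain ⟨⟨hxR, hxP⟩, hx0, hmax⟩ := hx
  have hRO : R ≤ O.toSubring := hbl.1
  haveI : IsDomain R := inferInstance
  -- `P` is generated by part `c` of a regular system of parameters
  obtain ⟨r, c, hc, hcP⟩ := exists_isRsopPart_span_range_eq (R := R) hP
  -- some `c j ≠ 0` (`x ∈ P` is nonzero); take `c i` of maximal value
  have hne : ∃ j ∈ (Finset.univ : Finset (Fin r)), ((c j : R) : K) ≠ 0 := by
    by_contra hcon
    have hall : ∀ j, c j = 0 := fun j => by
      by_contra hj
      exact hcon ⟨j, Finset.mem_univ j, fun h0 => hj (Subtype.ext h0)⟩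
    have hbot : Ideal.span (Set.range c) = ⊥ := by
      rw [Ideal.span_eq_bot]
      rintro _ ⟨j, rfl⟩
      exact hall j
    rw [hcP] at hbot
    rw [hbot] at hxP
    exact hx0 (congrArg Subtype.val ((Submodule.mem_bot _).mp hxP))
  obtain ⟨i, -, hi0, hmaxc⟩ := exists_max_valuation O Finset.univ (fun j => ((c j : R) : K)) hne
  have hci : c i ≠ 0 := fun h0 => hi0 (by rw [h0]; rfl)
  have hmaxc' : ∀ j, O.valuation ((c j : R) : K) ≤ O.valuation ((c i : R) : K) :=
    fun j => hmaxc j (Finset.mem_univ j)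
  -- the local blowing up in the `c i`-chart, and uniqueness
  have h' := SteeredRun.isLocalBlowupAlong_of_generators hRO c hcP i hci hmaxc'
  have hset : (fun y : R => (y : K) / (c i : K)) '' Set.range c =
      Set.range fun j => ((c j : R) : K) / ((c i : R) : K) := by
    rw [← Set.range_comp]
    rfl
  rw [hset] at h'
  have hR' : R' = locAtCentre
      (Subring.closure ((R : Set K) ∪ Set.range fun j => ((c j : R) : K) / ((c i : R) : K))) O :=
    SteeredRun.isLocalBlowupAlong_unique hbl h'
  subst hR'
  set C := Subring.closure ((R : Set K) ∪ Set.range fun j => ((c j : R) : K) / ((c i : R) : K)) with hCdef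
  have hRC : R ≤ C := fun z hz => Subring.subset_closure (Or.inl hz)
  have hCO : C ≤ O.toSubring := (le_locAtCentre _ O).trans h'.isLocalBlowup.target_le
  -- `c` is quasi-regular and `R ⧸ (c)` is a regular ring
  obtain ⟨e, z, hd, hz, hzc⟩ := hc.exists_rsop
  have hqr : IsQuasiRegular c := by
    have hq := isQuasiRegular_rsop_comp hd z hz (Fin.castAdd e) (Fin.castAdd_injective _ _)
    have hcomp : z ∘ Fin.castAdd e = c := funext fun j => hzc j
    rwa [hcomp] at hq
  haveI : IsRegularRing (R ⧸ Ideal.span (Set.range c)) := by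
    rw [hcP]; exact isRegularRing_of_isRegularLocalRing _
  -- the chart quotient `C/(c_i)` is a regular ring
  have hciC : ((c i : R) : K) ∈ C := hRC (c i).2
  haveI hCreg : IsRegularRing (C ⧸ Ideal.span {(⟨((c i : R) : K), hciC⟩ : C)}) :=
    isRegularRing_closure_quotient_span_singleton R c hqr i hci
  -- quotient and localisation commute
  have hcim : c i ∈ maximalIdeal R := hP (hcP ▸ Ideal.subset_span ⟨i, rfl⟩)
  have hvci : O.valuation ((c i : R) : K) < 1 := (hval (c i)).mp hcim
  have hregT := DivisorTrigger.isRegularLocalRing_locAtCentre_quotient hCO ⟨((c i : R) : K), hciC⟩ hvci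
  -- `x / c_i` is a unit of `R' = C_{centre}`: `x ∈ P` has the same (maximal) value as `c_i`
  have hxC : x / ((c i : R) : K) ∈ C := by
    have hmem : x / ((c i : R) : K) ∈
        Subring.closure ((R : Set K) ∪ (fun y : R => (y : K) / ((c i : R) : K)) '' (P : Set R)) :=
      Subring.subset_closure (Or.inr ⟨⟨x, hxR⟩, hxP, rfl⟩)
    rwa [SteeredRun.closure_union_image_div_eq_of_span_eq R ((c i : R) : K) (Set.range c) hcP, hset] at hmem
  have hvx : O.valuation x = O.valuation ((c i : R) : K) :=
    le_antisymm (valuation_le_of_mem_span_range hRO c i hmaxc' ⟨x, hxR⟩ (hcP ▸ hxP))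
      (hmax (c i) (hcP ▸ Ideal.subset_span ⟨i, rfl⟩))
  have hci0K : ((c i : R) : K) ≠ 0 := hi0
  have hvw : O.valuation (x / ((c i : R) : K)) = 1 := by
    rw [map_div₀, hvx, div_self ((_root_.map_ne_zero _).mpr hci0K)]
  have hwT : x / ((c i : R) : K) ∈ locAtCentre C O := le_locAtCentre _ O hxC
  have hwinv : (x / ((c i : R) : K))⁻¹ ∈ locAtCentre C O := inv_mem_locAtCentre hwT hvw
  have hxT : x ∈ locAtCentre C O := by
    have : x = x / ((c i : R) : K) * ((c i : R) : K) := by rw [div_mul_cancel₀ _ hci0K]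
    rw [this]
    exact Subring.mul_mem _ hwT (le_locAtCentre _ O hciC)
  refine ⟨hxT, ?_⟩
  -- `(x) = (c_i)` in `R'`
  set w : locAtCentre C O := ⟨x / ((c i : R) : K), hwT⟩ with hwdef
  have hwunit : IsUnit w := by
    refine isUnit_iff_exists_inv.mpr ⟨⟨(x / ((c i : R) : K))⁻¹, hwinv⟩, Subtype.ext ?_⟩
    change x / ((c i : R) : K) * (x / ((c i : R) : K))⁻¹ = 1
    exact mul_inv_cancel₀ (ne_zero_of_valuation_eq_one hvw)
  have hxeq : (⟨x, hxT⟩ : locAtCentre C O) =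
      algebraMap C (locAtCentre C O) ⟨((c i : R) : K), hciC⟩ * w := by
    apply Subtype.ext
    change x = ((c i : R) : K) * (x / ((c i : R) : K))
    rw [mul_div_cancel₀ _ hci0K]
  rw [hxeq, Ideal.span_singleton_mul_right_unit hwunit]
  exact hregT

end Summit.ResolutionOfSingularities.ResolutionOfSingularities.Theorems.SwitchingDichotomy.NoSingularCarrier

end
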